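import Mathlib
import Summits.NavierStokesRegularity.NavierStokesRegularity.Theorems.EulerZoomLiouvillePowerGaugeEulerLiouvilleDSSNodeSpectralSplitting
import HarnessLib.Audit

/-!
# Crux E `PowerGaugeEulerLiouville` (stmt-NavierStokesRegularity-19832): GROWTH OF `M^k` WHEN THE CHARACTERISTIC POLYNOMIAL SPLITS OVER `ℝ` — the Newton-basis
# bookkeeping `M^k = A_k + B_k(M − r_b) + C_k(M − r_b)(M − r_s)` with divided-difference coefficients (width seat ns-cas-k2 g3, tool E part 2)

Route `EulerZoomLiouville` (NavierStokesRegularity), crux E.  Companion of `…DSSNodeSpectralGrowth` (complex cofactor pair).  If an operator `M` on `ℝ³` satisfies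
`(M − λ₁)(M − r_s)(M − r_b) = 0` (three real roots, repetitions allowed) then, in the Newton basis `1, (X − r_b), (X − r_b)(X − r_s)` of `ℝ[X]/(χ)`,
`X^k ≡ A_k + B_k(X − r_b) + C_k(X − r_b)(X − r_s)` with `A_{k+1} = r_bA_k`, `B_{k+1} = A_k + r_sB_k`, `C_{k+1} = B_k + λ₁C_k` (divided differences of `x^k`),
and `|A_k| ≤ s^k`, `s|B_k| ≤ k s^k`, `s²|C_k| ≤ k²s^k` whenever `|r_b|, |r_s|, |λ₁| ≤ s` — UNIFORMLY over all coincidence patterns of the roots (no Jordan form):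
* `exists_newton_coeffs` — the coefficients with their bounds and the operator identity `M^k x = A_k x + B_k (Mx − r_b x) + C_k (M(Mx − r_bx) − r_s(Mx − r_bx))`
  (existential form: no definitions);
* **`norm_pow_le_of_realRoots_global`** — `s²‖M^k x‖ ≤ (k+1)²·s^k·(‖M‖ + s)²·‖x‖` for all `x`, `k`.

WHAT THIS IS NOT: not NS regularity, not the crux E — finite-dimensional linear algebra for hypothetical DSS blow-up members; 19832 is OPEN. [folklore]
-/

noncomputable section

set_option linter.dupNamespace false

open Set Filter Topology Function
open scoped RealInnerProductSpace

namespace Summit.NavierStokesRegularity.NavierStokesRegularity.Theorems.PowerGaugeEulerLiouville.DSSNodes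

/-- **Newton-basis bookkeeping (no definitions).**  Under `(M − λ₁)(M − r_s)(M − r_b) = 0` and `|r_b|, |r_s|, |λ₁| ≤ s` (`0 ≤ s`), for every `k` there are
reals `A, B, C` with `|A| ≤ s^k`, `s|B| ≤ k s^k`, `s²|C| ≤ k² s^k` and `M^k x = A x + B (Mx − r_bx) + C (M(Mx − r_bx) − r_s(Mx − r_bx))` for all `x`
(the divided differences of `x^k` at the nodes `r_b, r_s, λ₁`: `A_{k+1} = r_bA_k`, `B_{k+1} = A_k + r_sB_k`, `C_{k+1} = B_k + λ₁C_k`). [folklore] -/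
theorem exists_newton_coeffs (M : EuclideanSpace ℝ (Fin 3) →L[ℝ] EuclideanSpace ℝ (Fin 3)) {rb rs lam₁ s : ℝ}
    (hs : 0 ≤ s) (hrb : |rb| ≤ s) (hrs : |rs| ≤ s) (hl : |lam₁| ≤ s)
    (hχ : ∀ x : EuclideanSpace ℝ (Fin 3),
      M (M (M x - rb • x) - rs • (M x - rb • x)) = lam₁ • (M (M x - rb • x) - rs • (M x - rb • x)))
    (k : ℕ) :
    ∃ A B C : ℝ, |A| ≤ s ^ k ∧ s * |B| ≤ k * s ^ k ∧ s ^ 2 * |C| ≤ (k : ℝ) ^ 2 * s ^ k ∧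
      ∀ x : EuclideanSpace ℝ (Fin 3), (M ^ k) x = A • x + B • (M x - rb • x) + C • (M (M x - rb • x) - rs • (M x - rb • x)) := by
  induction k with
  | zero => exact ⟨1, 0, 0, by simp, by simp, by simp, fun x => by simp⟩
  | succ k ih =>
      obtain ⟨A, B, C, hA, hB, hC, hid⟩ := ih
      have hsk : 0 ≤ s ^ k := pow_nonneg hs k
      have hk0 : (0 : ℝ) ≤ k := Nat.cast_nonneg k
      refine ⟨rb * A, A + rs * B, B + lam₁ * C, ?_, ?_, ?_, fun x => ?_⟩
      · rw [abs_mul, pow_succ]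
        calc |rb| * |A| ≤ s * s ^ k := mul_le_mul hrb hA (abs_nonneg _) hs
          _ = s ^ k * s := by ring
      · push_cast
        calc s * |A + rs * B| ≤ s * (|A| + |rs| * |B|) := by
              refine mul_le_mul_of_nonneg_left ?_ hs
              calc |A + rs * B| ≤ |A| + |rs * B| := abs_add_le _ _
                _ = |A| + |rs| * |B| := by rw [abs_mul]
          _ = s * |A| + |rs| * (s * |B|) := by ring
          _ ≤ s * s ^ k + s * (k * s ^ k) := by
              have a1 : s * |A| ≤ s * s ^ k := mul_le_mul_of_nonneg_left hA hs
              have a2 : |rs| * (s * |B|) ≤ s * (k * s ^ k) := mul_le_mul hrs hB (mul_nonneg hs (abs_nonneg _)) hs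
              linarith
          _ = ((k : ℝ) + 1) * s ^ (k + 1) := by rw [pow_succ]; ring
      · push_cast
        calc s ^ 2 * |B + lam₁ * C| ≤ s ^ 2 * (|B| + |lam₁| * |C|) := by
              refine mul_le_mul_of_nonneg_left ?_ (pow_nonneg hs 2)
              calc |B + lam₁ * C| ≤ |B| + |lam₁ * C| := abs_add_le _ _
                _ = |B| + |lam₁| * |C| := by rw [abs_mul]
          _ = s * (s * |B|) + |lam₁| * (s ^ 2 * |C|) := by ring
          _ ≤ s * (k * s ^ k) + s * ((k : ℝ) ^ 2 * s ^ k) := by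
              have a1 : s * (s * |B|) ≤ s * (k * s ^ k) := mul_le_mul_of_nonneg_left hB hs
              have a2 : |lam₁| * (s ^ 2 * |C|) ≤ s * ((k : ℝ) ^ 2 * s ^ k) :=
                mul_le_mul hl hC (mul_nonneg (pow_nonneg hs 2) (abs_nonneg _)) hs
              linarith
          _ = ((k : ℝ) + (k : ℝ) ^ 2) * s ^ (k + 1) := by rw [pow_succ]; ring
          _ ≤ ((k : ℝ) + 1) ^ 2 * s ^ (k + 1) := by
              refine mul_le_mul_of_nonneg_right ?_ (pow_nonneg hs _)
              nlinarith
      · rw [pow_succ_apply', hid x, map_add, map_add, map_smul, map_smul, map_smul, hχ x]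
        simp only [map_sub, map_smul]
        module

/-- **GROWTH, REAL ROOTS (any coincidences).**  `(M − λ₁)(M − r_s)(M − r_b) = 0` with `|r_b|, |r_s|, |λ₁| ≤ s`, `0 ≤ s`:
`s²‖M^k x‖ ≤ (k+1)²·s^k·(‖M‖ + s)²·‖x‖`. [folklore] -/
theorem norm_pow_le_of_realRoots_global (M : EuclideanSpace ℝ (Fin 3) →L[ℝ] EuclideanSpace ℝ (Fin 3)) {rb rs lam₁ s : ℝ}
    (hs : 0 ≤ s) (hrb : |rb| ≤ s) (hrs : |rs| ≤ s) (hl : |lam₁| ≤ s)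
    (hχ : ∀ x : EuclideanSpace ℝ (Fin 3),
      M (M (M x - rb • x) - rs • (M x - rb • x)) = lam₁ • (M (M x - rb • x) - rs • (M x - rb • x)))
    (k : ℕ) (x : EuclideanSpace ℝ (Fin 3)) :
    s ^ 2 * ‖(M ^ k) x‖ ≤ ((k : ℝ) + 1) ^ 2 * s ^ k * (‖M‖ + s) ^ 2 * ‖x‖ := by
  obtain ⟨A, B, C, hA, hB, hC, hid⟩ := exists_newton_coeffs M hs hrb hrs hl hχ k
  have hsk : 0 ≤ s ^ k := pow_nonneg hs k
  have hk0 : (0 : ℝ) ≤ k := Nat.cast_nonneg k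
  -- norms of the Newton vectors
  set y₁ : EuclideanSpace ℝ (Fin 3) := M x - rb • x with hy₁
  set y₂ : EuclideanSpace ℝ (Fin 3) := M y₁ - rs • y₁ with hy₂
  have hn₁ : ‖y₁‖ ≤ (‖M‖ + s) * ‖x‖ := by
    calc ‖y₁‖ ≤ ‖M x‖ + ‖rb • x‖ := norm_sub_le _ _
      _ ≤ ‖M‖ * ‖x‖ + |rb| * ‖x‖ := by rw [norm_smul, Real.norm_eq_abs]; exact add_le_add (M.le_opNorm x) le_rfl
      _ ≤ (‖M‖ + s) * ‖x‖ := by nlinarith [norm_nonneg x]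
  have hn₂ : ‖y₂‖ ≤ (‖M‖ + s) ^ 2 * ‖x‖ := by
    calc ‖y₂‖ ≤ ‖M y₁‖ + ‖rs • y₁‖ := norm_sub_le _ _
      _ ≤ ‖M‖ * ‖y₁‖ + |rs| * ‖y₁‖ := by rw [norm_smul, Real.norm_eq_abs]; exact add_le_add (M.le_opNorm y₁) le_rfl
      _ ≤ (‖M‖ + s) * ‖y₁‖ := by nlinarith [norm_nonneg y₁]
      _ ≤ (‖M‖ + s) * ((‖M‖ + s) * ‖x‖) := mul_le_mul_of_nonneg_left hn₁ (by positivity)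
      _ = (‖M‖ + s) ^ 2 * ‖x‖ := by ring
  have hMs : 0 ≤ ‖M‖ + s := by positivity
  rw [hid x, ← hy₁, ← hy₂]
  calc s ^ 2 * ‖A • x + B • y₁ + C • y₂‖ ≤ s ^ 2 * (‖A • x‖ + ‖B • y₁‖ + ‖C • y₂‖) :=
        mul_le_mul_of_nonneg_left (norm_add₃_le) (pow_nonneg hs 2)
    _ = s ^ 2 * |A| * ‖x‖ + s * (s * |B|) * ‖y₁‖ + (s ^ 2 * |C|) * ‖y₂‖ := by
        rw [norm_smul, norm_smul, norm_smul, Real.norm_eq_abs, Real.norm_eq_abs, Real.norm_eq_abs]; ring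
    _ ≤ s ^ 2 * s ^ k * ‖x‖ + s * (k * s ^ k) * ((‖M‖ + s) * ‖x‖) + ((k : ℝ) ^ 2 * s ^ k) * ((‖M‖ + s) ^ 2 * ‖x‖) := by
        have a1 : s ^ 2 * |A| * ‖x‖ ≤ s ^ 2 * s ^ k * ‖x‖ :=
          mul_le_mul_of_nonneg_right (mul_le_mul_of_nonneg_left hA (pow_nonneg hs 2)) (norm_nonneg _)
        have a2 : s * (s * |B|) * ‖y₁‖ ≤ s * (k * s ^ k) * ((‖M‖ + s) * ‖x‖) :=
          mul_le_mul (mul_le_mul_of_nonneg_left hB hs) hn₁ (norm_nonneg _) (by positivity)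
        have a3 : (s ^ 2 * |C|) * ‖y₂‖ ≤ ((k : ℝ) ^ 2 * s ^ k) * ((‖M‖ + s) ^ 2 * ‖x‖) :=
          mul_le_mul hC hn₂ (norm_nonneg _) (by positivity)
        linarith
    _ ≤ ((k : ℝ) + 1) ^ 2 * s ^ k * (‖M‖ + s) ^ 2 * ‖x‖ := by
        -- `s² ≤ (‖M‖+s)²`, `s(‖M‖+s) ≤ (‖M‖+s)²`, and `1 + k + k² ≤ (k+1)²`
        have b1 : s ^ 2 ≤ (‖M‖ + s) ^ 2 := pow_le_pow_left₀ hs (by linarith [norm_nonneg M]) 2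
        have b2 : s * (‖M‖ + s) ≤ (‖M‖ + s) ^ 2 := by rw [sq]; exact mul_le_mul_of_nonneg_right (by linarith [norm_nonneg M]) hMs
        have hx0 : 0 ≤ ‖x‖ := norm_nonneg x
        have c1 : s ^ 2 * s ^ k * ‖x‖ ≤ (‖M‖ + s) ^ 2 * s ^ k * ‖x‖ := by
          have := mul_le_mul_of_nonneg_right (mul_le_mul_of_nonneg_right b1 hsk) hx0; linarith
        have c2 : s * (k * s ^ k) * ((‖M‖ + s) * ‖x‖) ≤ k * ((‖M‖ + s) ^ 2 * s ^ k * ‖x‖) := by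
          have := mul_le_mul_of_nonneg_right (mul_le_mul_of_nonneg_right b2 hsk) hx0
          nlinarith
        nlinarith [c1, c2, mul_nonneg (mul_nonneg (pow_nonneg hMs 2) hsk) hx0]

end Summit.NavierStokesRegularity.NavierStokesRegularity.Theorems.PowerGaugeEulerLiouville.DSSNodes

end
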